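import Summits.ResolutionOfSingularities.ResolutionOfSingularities.Theorems.WeightedInvariantIota3RowADominanceTransport

/-!
# (F-3e) Row A for all competing flags — the (β) ENGINE and frame-free helpers  [OURS · L1 W4.3]

Kernel infrastructure for RE-ENTRY OBJECT #1 of chain w43 (door crux `stmt-ResolutionOfSingularities-19897`),
rung (F-3e): Row A of res-D-brk-1's Frobenius-class argument (O70B-JCAN-PLAN §7) for an ARBITRARY frame `(x, v, y)`
of the germ `y^p + Λ v^d + x^M` — the `x`-sharing hypothesis of `RowA.rowA_core` (file `…Iota3RowADominance`) is
not needed.  This file extracts the case-(β) engine of that proof as a lemma and adds the frame-free helpers: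

* `r₂_lt_weightedOrder_rest` — THE (β) ENGINE: if the initial form of `v` is `X₀^{m₀}` with `p ∣ m₀`, `q m₀ < r₂`,
  and `W(y^p + Λ v^d) ≥ N = d r₂` (`p ∤ d`, `d ≥ 2`), then the non-class-`0` part `R = v − v_0` has `W(R) > r₂`;
* `le_weightedOrder_of_constantCoeff_eq_zero` — every `x ∈ 𝔪` has `W(x) ≥ q` (`q ≤ r₂ ≤ r₁`);
* `coeff_linear_eq_zero_of_reach` — Frobenius: `W(y^p + Λ v^d + x^M) ≥ N > p·w_i` kills the `X_i`-coefficient of `y`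
  (`x, v ∈ 𝔪`, `p < d`, `p < M`);
* `false_of_frame₂` — an r.s.p. `(x, v, y)` cannot have `v̄, ȳ ∈ K·X̄₂`.

[OURS · L1 W4.3] NOT a statement of the manuscript; AI-produced, gate-checked, weaker than expert review.
-/

set_option linter.dupNamespace false

namespace Summit.ResolutionOfSingularities.ResolutionOfSingularities.Theorems.LocalEngine.Iota3.RowA

open MvPowerSeries IsLocalRing
open Summit.ResolutionOfSingularities.ResolutionOfSingularities.Theorems.LocalEngine.Iota3.PClass
open Summit.ResolutionOfSingularities.ResolutionOfSingularities.Cruxes.HypersurfaceCentreConstruction.LocalEngine.Iota3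

variable {K : Type*} [Field K]

/-! ## The (β) engine -/

/-- **THE (β) ENGINE.**  Weights `(q, r₂, r₁)`.  If the initial form of `v` is the single monomial `X₀^{m₀}` with
`p ∣ m₀` and `q m₀ < r₂`, and `W(y^p + Λ v^d) ≥ N = d r₂` with `p ∤ d`, `2 ≤ d`, `Λ ≠ 0`, then the non-class-`0`
part `R = v − v_0` of `v` weighs MORE than `r₂`: the `k = 1` term `d·R·G^{d−1}` of the class expansion of `v^d`
(`G = v_0`) has exact order `W(R) + (d−1) q m₀`, strictly below the `k ≥ 2` terms, and must reach `N`. -/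
theorem r₂_lt_weightedOrder_rest (p : ℕ) [Fact p.Prime] [CharP K p] {d q r₁ r₂ N : ℕ} (hpd : ¬ p ∣ d)
    (hd2 : 2 ≤ d) (hN₂ : d * r₂ = N) (hqr : q < r₂) {Λ : K} (hΛ : Λ ≠ 0) {y v : MvPowerSeries (Fin 3) K}
    {m₀ : ℕ} (hcm : coeff (Finsupp.single 0 m₀) v ≠ 0)
    (hini : ∀ e, coeff e v ≠ 0 → e ≠ Finsupp.single 0 m₀ →
      Finsupp.weight ![q, r₂, r₁] (Finsupp.single 0 m₀) < Finsupp.weight ![q, r₂, r₁] e)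
    (ham : q * m₀ < r₂) (hpm : p ∣ m₀)
    (hWh : (N : ℕ∞) ≤ (y ^ p + C Λ * v ^ d).weightedOrder ![q, r₂, r₁]) :
    (r₂ : ℕ∞) < (v - pClassComponent p 0 v).weightedOrder ![q, r₂, r₁] := by
  classical
  haveI : NeZero p := ⟨(Fact.out : p.Prime).ne_zero⟩
  set G := pClassComponent p 0 v with hGdef
  set R := v - pClassComponent p 0 v with hRdef
  have hclass : exponentClass p (Finsupp.single (0 : Fin 3) m₀) = 0 := by
    rw [exponentClass_eq_zero_iff]
    intro i
    rw [Finsupp.single_apply]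
    split_ifs
    · exact hpm
    · exact dvd_zero p
  have hWG : G.weightedOrder ![q, r₂, r₁] = ((q * m₀ : ℕ) : ℕ∞) := by
    have h := weightedOrder_pClassComponent_of_initialMonomial (![q, r₂, r₁]) p hcm hini
    rw [hclass, weight_single_zero] at h
    exact h
  have hWR : ((q * m₀ : ℕ) : ℕ∞) < R.weightedOrder ![q, r₂, r₁] := by
    have h := weight_lt_weightedOrder_sub_pClassComponent_of_initialMonomial (![q, r₂, r₁]) p hini
    rw [hclass, weight_single_zero] at h
    exact h
  have hG0 : pClassComponent p 0 G = G := by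
    rw [hGdef, pClassComponent_pClassComponent, if_pos rfl]
  have hR0 : pClassComponent p 0 R = 0 := pClassComponent_sub_pClassComponent_self p 0 v
  by_contra hρ
  push Not at hρ
  have hRne : R.weightedOrder ![q, r₂, r₁] ≠ ⊤ := ne_top_of_le_ne_top (ENat.coe_ne_top r₂) hρ
  obtain ⟨ρ, hρeq⟩ : ∃ ρ : ℕ, R.weightedOrder ![q, r₂, r₁] = ρ := ⟨_, (ENat.coe_toNat hRne).symm⟩
  rw [hρeq, Nat.cast_le] at hρ
  rw [hρeq, Nat.cast_lt] at hWR
  -- the non-class-0 part `Q` of `v^d` has `W(Q) ≥ N` (coefficientwise)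
  set Q := v ^ d - pClassComponent p 0 (v ^ d) with hQdef
  have hhQ : y ^ p + C Λ * v ^ d - pClassComponent p 0 (y ^ p + C Λ * v ^ d) = C Λ * Q := by
    rw [pClassComponent_add, pClassComponent_zero_pow_expChar, pClassComponent_C_mul, hQdef]
    ring
  have hQ : ∀ e : Fin 3 →₀ ℕ, Finsupp.weight ![q, r₂, r₁] e < N → coeff e Q = 0 := by
    intro e he
    have h1 : coeff e (C Λ * Q) = 0 := by
      rw [← hhQ]
      refine coeff_eq_zero_of_lt_weightedOrder _ (lt_of_lt_of_le ?_
        (hWh.trans (le_weightedOrder_sub_pClassComponent _ p 0 _)))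
      exact_mod_cast he
    rw [coeff_C_mul] at h1
    exact (mul_eq_zero.mp h1).resolve_left hΛ
  -- binomial expansion of `v^d = (R + G)^d` by classes
  have hGpow : ∀ j, pClassComponent p 0 (G ^ j) = G ^ j := pClassComponent_zero_pow_of_pure p hG0
  have hP : ∀ k, pClassComponent p 0 (G ^ (d - k) * (d.choose k : MvPowerSeries (Fin 3) K)) =
      G ^ (d - k) * (d.choose k : MvPowerSeries (Fin 3) K) := fun k => by
    rw [← map_natCast (C : K →+* MvPowerSeries (Fin 3) K), mul_comm, pClassComponent_C_mul, hGpow]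
  have hvRG : v = R + G := by rw [hRdef, hGdef, sub_add_cancel]
  have hQsum : Q = ∑ k ∈ Finset.range (d + 1),
      (R ^ k - pClassComponent p 0 (R ^ k)) * (G ^ (d - k) * (d.choose k : MvPowerSeries (Fin 3) K)) := by
    rw [hQdef, hvRG, add_pow, pClassComponent_sum, ← Finset.sum_sub_distrib]
    refine Finset.sum_congr rfl fun k _ => ?_
    rw [mul_assoc, pClassComponent_mul_of_right_pure_zero (hP k), sub_mul]
  -- orders of the terms
  have hWd : ((d : ℕ) : MvPowerSeries (Fin 3) K).weightedOrder ![q, r₂, r₁] = 0 := by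
    rw [← map_natCast (C : K →+* MvPowerSeries (Fin 3) K)]
    exact weightedOrder_C _ ((CharP.cast_eq_zero_iff K p d).not.mpr hpd)
  have hT1 : ((R ^ 1 - pClassComponent p 0 (R ^ 1)) * (G ^ (d - 1) * (d.choose 1 : MvPowerSeries (Fin 3) K))).weightedOrder
      ![q, r₂, r₁] = ((ρ + (d - 1) * (q * m₀) : ℕ) : ℕ∞) := by
    rw [pow_one, hR0, sub_zero, Nat.choose_one_right, weightedOrder_mul, weightedOrder_mul, weightedOrder_pow,
      hWG, hWd, hρeq, add_zero, nsmul_eq_mul]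
    push_cast
    ring
  have hTk : ∀ k ∈ Finset.range (d + 1), 2 ≤ k →
      (((ρ + (d - 1) * (q * m₀) : ℕ) : ℕ∞)) <
        ((R ^ k - pClassComponent p 0 (R ^ k)) * (G ^ (d - k) * (d.choose k : MvPowerSeries (Fin 3) K))).weightedOrder
          ![q, r₂, r₁] := by
    intro k hk hk2
    rw [Finset.mem_range] at hk
    have hnum := lt_binomial_weight hk2 (Nat.lt_succ_iff.mp hk) hWR
    refine lt_of_lt_of_le (b := (((k * ρ + (d - k) * (q * m₀) : ℕ) : ℕ∞))) (by exact_mod_cast hnum) ?_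
    refine le_trans ?_ (le_weightedOrder_mul _)
    have h1 : (((k * ρ : ℕ)) : ℕ∞) ≤ (R ^ k - pClassComponent p 0 (R ^ k)).weightedOrder ![q, r₂, r₁] := by
      refine le_trans ?_ (le_weightedOrder_sub_pClassComponent _ p 0 _)
      rw [weightedOrder_pow, hρeq, nsmul_eq_mul, Nat.cast_mul]
    have h2 : ((((d - k) * (q * m₀) : ℕ)) : ℕ∞) ≤
        (G ^ (d - k) * (d.choose k : MvPowerSeries (Fin 3) K)).weightedOrder ![q, r₂, r₁] := by
      refine le_trans ?_ (le_weightedOrder_mul _)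
      rw [weightedOrder_pow, hWG, nsmul_eq_mul, Nat.cast_mul]
      exact le_self_add
    push_cast at h1 h2 ⊢
    exact add_le_add h1 h2
  -- the `k = 1` term has a nonzero coefficient of weight `ρ + (d-1)a`, invisible to the other terms
  have hfin : ((((R ^ 1 - pClassComponent p 0 (R ^ 1)) * (G ^ (d - 1) * (d.choose 1 : MvPowerSeries (Fin 3) K))).weightedOrder
      ![q, r₂, r₁]).toNat : ℕ∞) =
      ((R ^ 1 - pClassComponent p 0 (R ^ 1)) * (G ^ (d - 1) * (d.choose 1 : MvPowerSeries (Fin 3) K))).weightedOrder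
        ![q, r₂, r₁] := by
    rw [hT1]; rfl
  obtain ⟨e, hce, hwe⟩ := exists_coeff_ne_zero_and_weightedOrder _ hfin
  rw [hT1, Nat.cast_inj] at hwe
  have hcoeffQ : coeff e Q = coeff e ((R ^ 1 - pClassComponent p 0 (R ^ 1)) *
      (G ^ (d - 1) * (d.choose 1 : MvPowerSeries (Fin 3) K))) := by
    rw [hQsum, map_sum]
    refine Finset.sum_eq_single 1 (fun k hk hk1 => ?_) (fun h => absurd (Finset.mem_range.mpr (by omega)) h)
    rcases Nat.lt_or_ge k 2 with hk2 | hk2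
    · -- k = 0
      have hk0 : k = 0 := by omega
      have h1 : pClassComponent p 0 (1 : MvPowerSeries (Fin 3) K) = 1 := by
        have h := hGpow 0
        rwa [pow_zero] at h
      rw [hk0, pow_zero, h1, sub_self, zero_mul, map_zero]
    · refine coeff_eq_zero_of_lt_weightedOrder (![q, r₂, r₁]) ?_
      rw [hwe]
      exact hTk k hk hk2
  have hlight : Finsupp.weight ![q, r₂, r₁] e < N := by
    rw [hwe, ← hN₂]
    have h1 : (d - 1) * (q * m₀) ≤ (d - 1) * (r₂ - 1) := Nat.mul_le_mul_left _ (by omega)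
    have h2 : ρ + (d - 1) * (r₂ - 1) < d * r₂ := by
      obtain ⟨j, rfl⟩ := Nat.exists_eq_add_of_le hd2
      obtain ⟨i, rfl⟩ := Nat.exists_eq_add_of_le (Nat.one_le_of_lt hqr)
      rw [show 2 + j - 1 = j + 1 by omega, show 1 + i - 1 = i by omega]
      nlinarith
    omega
  exact absurd (hcoeffQ ▸ hQ e hlight) hce

/-! ## Frame-free helpers -/

/-- Every series without constant term weighs at least `q` for the weights `(q, r₂, r₁)`, `q ≤ r₂ ≤ r₁`. -/
theorem le_weightedOrder_of_constantCoeff_eq_zero {q r₁ r₂ : ℕ} (hq : q ≤ r₂) (hr : r₂ ≤ r₁)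
    {x : MvPowerSeries (Fin 3) K} (hx : constantCoeff x = 0) : (q : ℕ∞) ≤ x.weightedOrder ![q, r₂, r₁] := by
  refine nat_le_weightedOrder _ fun e he => ?_
  rw [weight_vec] at he
  have h0 : e 0 = 0 := by
    by_contra h; have : 1 ≤ e 0 := Nat.one_le_iff_ne_zero.mpr h; nlinarith
  have h1 : e 1 = 0 := by
    by_contra h; have : 1 ≤ e 1 := Nat.one_le_iff_ne_zero.mpr h; nlinarith
  have h2 : e 2 = 0 := by
    by_contra h; have : 1 ≤ e 2 := Nat.one_le_iff_ne_zero.mpr h; nlinarith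
  have he0 : e = 0 := by
    ext i; fin_cases i
    · simpa using h0
    · simpa using h1
    · simpa using h2
  rw [he0, coeff_zero_eq_constantCoeff_apply, hx]

/-- `W(x^M) ≥ N` for `x ∈ 𝔪` and `M q = N`. -/
theorem le_weightedOrder_pow_of_constantCoeff_eq_zero {q r₁ r₂ M N : ℕ} (hq : q ≤ r₂) (hr : r₂ ≤ r₁)
    (hN : M * q = N) {x : MvPowerSeries (Fin 3) K} (hx : constantCoeff x = 0) :
    (N : ℕ∞) ≤ (x ^ M).weightedOrder ![q, r₂, r₁] := by
  refine le_trans ?_ (le_weightedOrder_pow _ M)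
  rw [← hN, Nat.cast_mul, nsmul_eq_mul]
  have h := le_weightedOrder_of_constantCoeff_eq_zero (K := K) hq hr hx
  gcongr

/-- FROBENIUS ON THE LINEAR COEFFICIENTS: from `W(y^p + Λ v^d + x^M) ≥ N > p·w_i` (with `v, x ∈ 𝔪`, `p < d`,
`p < M`), the `X_i`-coefficient of `y` vanishes. -/
theorem coeff_linear_eq_zero_of_reach (p : ℕ) [Fact p.Prime] [CharP K p] {d M N : ℕ} (hlt : p < d)
    (hpM : p < M) (w : Fin 3 → ℕ) (i : Fin 3) (hi : p * w i < N) {Λ : K} {x y v : MvPowerSeries (Fin 3) K}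
    (hv0 : constantCoeff v = 0) (hx0 : constantCoeff x = 0)
    (hreach : (N : ℕ∞) ≤ (y ^ p + C Λ * v ^ d + x ^ M).weightedOrder w) :
    coeff (Finsupp.single i 1) y = 0 := by
  classical
  have hw : Finsupp.weight w (p • Finsupp.single i 1) = p * w i := by
    rw [Finsupp.smul_single, smul_eq_mul, mul_one, Finsupp.weight_single, smul_eq_mul]
  have hz : coeff (p • Finsupp.single i 1) (y ^ p + C Λ * v ^ d + x ^ M) = 0 :=
    coeff_eq_zero_of_lt_weightedOrder _ (lt_of_lt_of_le (by rw [hw]; exact_mod_cast hi) hreach)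
  rw [map_add, map_add, coeff_nsmul_pow_expChar, coeff_C_mul,
    coeff_pow_eq_zero_of_degree_lt hv0 (by rw [degree_nsmul_single]; exact hlt), mul_zero, add_zero,
    coeff_pow_eq_zero_of_degree_lt hx0 (by rw [degree_nsmul_single]; exact hpM), add_zero] at hz
  exact pow_eq_zero_iff (Nat.Prime.ne_zero Fact.out) |>.mp hz

/-- THE FRAME CONTRADICTION, frame-free form: an r.s.p. `(x, v, y)` (here: `X₀, X₁ ∈ (x, v, y)`, all without
constant term) cannot have `v` and `y` both without `X₀`- and `X₁`-terms. -/
theorem false_of_frame₂ {x v y : MvPowerSeries (Fin 3) K}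
    (hX0 : (X 0 : MvPowerSeries (Fin 3) K) ∈ Ideal.span {x, v, y})
    (hX1 : (X 1 : MvPowerSeries (Fin 3) K) ∈ Ideal.span {x, v, y})
    (hx0 : constantCoeff x = 0) (hv0 : constantCoeff v = 0) (hy0 : constantCoeff y = 0)
    (hv₀ : coeff (Finsupp.single 0 1) v = 0) (hv₁ : coeff (Finsupp.single 1 1) v = 0)
    (hy₀ : coeff (Finsupp.single 0 1) y = 0) (hy₁ : coeff (Finsupp.single 1 1) y = 0) : False := by
  classical
  have hlin : ∀ (i : Fin 3) (r s t : MvPowerSeries (Fin 3) K), coeff (Finsupp.single i 1) (r * x + s * v + t * y) =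
      constantCoeff r * coeff (Finsupp.single i 1) x + constantCoeff s * coeff (Finsupp.single i 1) v +
        constantCoeff t * coeff (Finsupp.single i 1) y := by
    intro i r s t
    rw [map_add, map_add, coeff_single_one_mul i r _ hx0, coeff_single_one_mul i s _ hv0,
      coeff_single_one_mul i t _ hy0]
  obtain ⟨r, s, t, h0⟩ := exists_of_mem_span_triple hX0
  obtain ⟨r', s', t', h1⟩ := exists_of_mem_span_triple hX1
  have e00 := congrArg (coeff (Finsupp.single (0 : Fin 3) 1)) h0
  have e01 := congrArg (coeff (Finsupp.single (1 : Fin 3) 1)) h0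
  have e11 := congrArg (coeff (Finsupp.single (1 : Fin 3) 1)) h1
  rw [hlin, coeff_index_single_X, if_pos rfl, hv₀, hy₀, mul_zero, mul_zero, add_zero, add_zero] at e00
  rw [hlin, coeff_index_single_X, if_neg (by decide), hv₁, hy₁, mul_zero, mul_zero, add_zero, add_zero] at e01
  rw [hlin, coeff_index_single_X, if_pos rfl, hv₁, hy₁, mul_zero, mul_zero, add_zero, add_zero] at e11
  -- `1 = r(0)·x₀`, `0 = r(0)·x₁`, `1 = r'(0)·x₁`
  have hx₁ : coeff (Finsupp.single 1 1) x = 0 := by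
    rcases mul_eq_zero.mp e01.symm with h | h
    · rw [h, zero_mul] at e00
      exact absurd e00 one_ne_zero
    · exact h
  rw [hx₁, mul_zero] at e11
  exact one_ne_zero e11

end Summit.ResolutionOfSingularities.ResolutionOfSingularities.Theorems.LocalEngine.Iota3.RowA
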